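import Mathlib

/-!
# Venture AbcShadow — SH-02 STATEMENT: `x² − 73^{2k+1} = yⁿ`, `73 ∤ x`, `y` odd, `n ≥ 3` (the case `D73`)

HONEST FRAMING. Statement file of the work-bound cell `abc-shadow` (row SH-02 of its census; typer seat
`abc-shadow-typ-2`). This file PROVES NOTHING about the equation: it types the TARGET of the row as a plain `Prop`
(`D73`), in the binder style of `Summits/Ventures/AbcShadow/SH01/Statement.lean`. ADJACENT result (a
Lebesgue–Nagell-type equation, [BS23] = M. A. Bennett, S. Siksek, "Differences between perfect powers: prime power
gaps", Algebra & Number Theory 17 (2023) 1789–1846, equation (5) `x² − q^{2k+1} = yⁿ`, `q ∤ x`, `n ≥ 3`), NOT abc: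
nothing here is a claim on the abc conjecture or on any summit, and nothing here takes a side on IUT.

In print ([BS23, Thm 3, p. 1791]) the case `q = 73` is solved for `3 ≤ n ≤ 1000` (seven solutions, exactly one with `y`
odd: `10² − 73 = 3³`) and, for `n > 1000`, only for `y` even; the case `q = 73`, `y` odd, prime `n > 1000` is left
open there (Remark after Lemma 14.3, p. 1832: "around 60 years" of sieving up to `n < 6 × 10⁶`). `D73` is the cell's
DERIVED statement closing that case (census words: "D73 (DERIVED + INDEPENDENTLY RE-CHECKED, modulo print)"); the
conditional derivation — from NAMED print hypotheses [BS23, Prop. 14.1 + Table 3, Lemma 14.2 (+ Lemma 7.1), Thm 3]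
and the COMPUTED kill-prime data at `ℓ = 7841` (`k` odd) and `ℓ = 41189` (`k` even) — is `SH02/RowD73.lean`.
Print's status word for this case remains OPEN; "derived" is the cell's word, never "proved in print".
-/

namespace Summit.Ventures.AbcShadow

/-- **D73** (census row SH-02 of the cell `abc-shadow`, the `y`-odd case of [BS23, eq. (5)] at `q = 73`)
[cite: BennettSiksek2023, Thm 3 p.1791 (q = 73: print covers 3 ≤ n ≤ 1000 and, for n > 1000, y even only)]:
every solution of `x² − 73^{2k+1} = yⁿ` in integers `x, y` and naturals `n ≥ 3`, `k ≥ 0` with `73 ∤ x` and `y` odd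
is `(±10)² − 73 = 3³`, i.e. `x = ±10`, `y = 3`, `n = 3`, `k = 0`. This is the TARGET `Prop`; nothing is asserted.
ADJACENT (Lebesgue–Nagell type), NOT abc. -/
def D73 : Prop :=
  ∀ (x y : ℤ) (n k : ℕ), x ^ 2 - 73 ^ (2 * k + 1) = y ^ n → ¬ (73 : ℤ) ∣ x → Odd y → 3 ≤ n →
    (x = 10 ∨ x = -10) ∧ y = 3 ∧ n = 3 ∧ k = 0

/-- Sanity check of the target's shape: the printed solution `10² − 73 = 3³` [BS23, Thm 3: `(q, k, y, n) = (73, 0, 3, 3)`]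
does satisfy the hypotheses of `D73` (so `D73` is not vacuous) and its conclusion. [cite: BennettSiksek2023, Thm 3 p.1791] -/
theorem d73_witness :
    (10 : ℤ) ^ 2 - 73 ^ (2 * 0 + 1) = (3 : ℤ) ^ 3 ∧ ¬ (73 : ℤ) ∣ 10 ∧ Odd (3 : ℤ) ∧ 3 ≤ 3 := by
  refine ⟨by norm_num, by decide, ⟨1, by norm_num⟩, le_rfl⟩

end Summit.Ventures.AbcShadow
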